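/-
Copyright (c) 2026. All rights reserved.
Released under Apache 2.0 license as described in the file LICENSE.
-/
import Literature.NumberTheory.Automorphic.MaximalOrderDiscFiveLattice
import HarnessLib

/-!
# The ramified prime `5` of the maximal order `O₅` of `(−2,−5 ∣ ℚ)`: left multiplication by `j` (`nrd j = 5`) is the explicit
# bijection `(A,B,C,D) ↦ (−A−2B−4C, −A+B+2D, 2A+C−D, −4B−2C−D)` from `{Q₅ = n}` onto `{Q₅ = 5n}` for the norm form
# `Q₅ = a² + 2b² + 2c² + d² + ac − ad + 2bc + bd`; hence `r₅(5n) = r₅(n)`, `r₅(5ᵃ) = 6`, `#{x ∈ O₅ : nrd x = 5n} = #{x ∈ O₅ : nrd x = n}`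

[tag: quaternion_algebra] [tag: quadratic_form] [tag: ramification]

Topic `NumberTheory/Automorphic`; THEOREMS ONLY (no definition, no named fact, no instance; net Literature debt `0`).
Lane `lit-hodgefound`, seat p12, gen 45 — third file on the definite quaternion order of discriminant `5` (after
`MaximalOrderDiscFiveLattice`, `MaximalOrderDiscFiveRamification`), the `D = 5` counterpart of `MaximalOrderDiscThreeNormsThreeMul`.
At the ramified prime `5` the maximal order `O₅ = ℤ⟨1, i, α, η⟩` has the two-sided ideal `jO₅` (`j = 2α − 1 − i`, `nrd j = 5`,
`O₅/jO₅ ≅ 𝔽₂₅`), so `5 ∣ nrd x ⟺ x ∈ jO₅` and `x ↦ jx` is a bijection `{nrd = n} → {nrd = 5n}` (Eichler LNM 320 II §2: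
`ζ_p(s) = (1 − p^{−2s})⁻¹` for `p ∣ D`; §6 Thm. 2 (20)). In the coordinates `x = a + bi + cα + dη`
(`MaximalOrderDiscFiveLattice.reducedNorm_mk`) everything is explicit on `ℤ⁴` and needs no class number:

* §1 `basisJ_mul_mk` (**`j·(A + Bi + Cα + Dη) = (−A−2B−4C) + (−A+B+2D)i + (2A+C−D)α + (−4B−2C−D)η`**), `reducedNorm_basisJ` (`= 5`),
  `form_fiveMap` (`Q₅(φv) = 5Q₅(v)`), **`five_dvd_form_iff`** (**`5 ∣ Q₅(a,b,c,d) ⟺ a + 3c + 2d ≡ 0 ∧ b + 3c − d ≡ 0 (mod 5)`**),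
  **`natCard_form_five_mul`** (`#{Q₅ = 5n} = #{Q₅ = n}`), `natCard_form_five_pow_mul`, **`natCard_form_five_pow`** (`r₅(5ᵃ) = 6`);
* §2 for `O₅`: **`natCard_reducedNorm_five_mul`** (`#{x ∈ O₅ : nrd x = 5n} = #{x ∈ O₅ : nrd x = n}`), `natCard_reducedNorm_five_pow`
  (`= 6`), `exists_mem_eq_basisJ_mul_of_five_dvd` (`x ∈ O₅`, `5 ∣ nrd x ⟹ x = jy`, `y ∈ O₅`).

## Sources

* M. Eichler, LNM 320 (1973), Ch. II §2 (`ζ_p(s) = (1 − p^{−2s})⁻¹`, `p ∣ D`: one integral ideal of each norm `pᵃ`) and §6 Thm. 2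
  (20). [cite: Eichler1973, Ch. II §2 and §6 Thm. 2 (20)]
* M.-F. Vignéras, LNM 800 (1980), Ch. II §1 Lemme 1.5, Cor. 1.7 (the unique maximal ideal `P = Ou = uO` above a ramified
  prime). [cite: VignerasLNM800, Ch. II §1 Lemme 1.5 and Cor. 1.7]
* J. Voight, *Quaternion Algebras*, GTM 288 (2021), Exercise 17.10, Thm. 25.4.1 (`D = 5`), §13.3. [cite: Voight2021, Exercise 17.10; §13.3]

## Scope (honest)

Theorems only — no definition, no named fact, no instance. The class number of `O₅` (Euclidean property, Voight Ex. 17.10 ∕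
Fitzgerald 2012) and its Brandt matrices are NOT treated here; this file is the part of the `D = 5` story that is independent of them.
-/

open Quaternion
open scoped Pointwise

namespace Literature.NumberTheory.Automorphic.MaxOrderDiscFive

/-! ## §1 The `5`-map on `ℤ⁴` -/

section Form

/-- **Left multiplication by `j` in the coordinates of `O₅`: `j·(A + Bi + Cα + Dη) = (−A−2B−4C) + (−A+B+2D)i + (2A+C−D)α + (−4B−2C−D)η`.**
[cite: VignerasLNM800, Ch. II §1 Lemme 1.5] -/
theorem basisJ_mul_mk (A B C D : ℤ) :
    (⟨0, 0, 1, 0⟩ : ℍ[ℚ,-2,-5]) * ⟨(A : ℚ) + (C : ℚ) / 2 - (D : ℚ) / 2, (B : ℚ) + (C : ℚ) / 2 + (D : ℚ) / 4, (C : ℚ) / 2, (D : ℚ) / 4⟩ =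
      ⟨((-A - 2 * B - 4 * C : ℤ) : ℚ) + ((2 * A + C - D : ℤ) : ℚ) / 2 - ((-4 * B - 2 * C - D : ℤ) : ℚ) / 2,
        ((-A + B + 2 * D : ℤ) : ℚ) + ((2 * A + C - D : ℤ) : ℚ) / 2 + ((-4 * B - 2 * C - D : ℤ) : ℚ) / 4,
        ((2 * A + C - D : ℤ) : ℚ) / 2, ((-4 * B - 2 * C - D : ℤ) : ℚ) / 4⟩ := by
  ext <;> simp [QuaternionAlgebra.mk_mul_mk] <;> ring

/-- **`nrd j = 5`**: `j` is a uniformiser at the ramified prime. [cite: VignerasLNM800, Ch. II §1 Lemme 1.5] -/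
theorem reducedNorm_basisJ : reducedNorm ℚ ℍ[ℚ,-2,-5] (⟨0, 0, 1, 0⟩ : ℍ[ℚ,-2,-5]) = 5 := by
  rw [reducedNorm_eq]
  norm_num

/-- `Q₅(−A−2B−4C, −A+B+2D, 2A+C−D, −4B−2C−D) = 5·Q₅(A,B,C,D)` (`nrd(jx) = 5·nrd x`). [cite: Eichler1973, Ch. II §6 Thm. 2 (20)] -/
theorem form_fiveMap (A B C D : ℤ) :
    (-A - 2 * B - 4 * C) ^ 2 + 2 * (-A + B + 2 * D) ^ 2 + 2 * (2 * A + C - D) ^ 2 + (-4 * B - 2 * C - D) ^ 2 +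
        (-A - 2 * B - 4 * C) * (2 * A + C - D) - (-A - 2 * B - 4 * C) * (-4 * B - 2 * C - D) +
        2 * (-A + B + 2 * D) * (2 * A + C - D) + (-A + B + 2 * D) * (-4 * B - 2 * C - D) =
      5 * (A ^ 2 + 2 * B ^ 2 + 2 * C ^ 2 + D ^ 2 + A * C - A * D + 2 * B * C + B * D) := by
  ring

/-- **`5 ∣ Q₅(a,b,c,d) ⟺ a + 3c + 2d ≡ 0 ∧ b + 3c − d ≡ 0 (mod 5)`** (`O₅/jO₅ ≅ 𝔽₂₅` is a field: the norm form vanishes mod `5`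
exactly on the image of the `5`-map). [cite: VignerasLNM800, Ch. II §1 Cor. 1.7] [cite: Voight2021, §13.3] -/
theorem five_dvd_form_iff (a b c d : ℤ) :
    (5 : ℤ) ∣ a ^ 2 + 2 * b ^ 2 + 2 * c ^ 2 + d ^ 2 + a * c - a * d + 2 * b * c + b * d ↔
      (5 : ℤ) ∣ a + 3 * c + 2 * d ∧ (5 : ℤ) ∣ b + 3 * c - d := by
  have key : ∀ x y z w : ZMod 5, x ^ 2 + 2 * y ^ 2 + 2 * z ^ 2 + w ^ 2 + x * z - x * w + 2 * y * z + y * w = 0 ↔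
      x + 3 * z + 2 * w = 0 ∧ y + 3 * z - w = 0 := by decide
  have e₁ := ZMod.intCast_zmod_eq_zero_iff_dvd (a ^ 2 + 2 * b ^ 2 + 2 * c ^ 2 + d ^ 2 + a * c - a * d + 2 * b * c + b * d) 5
  have e₂ := ZMod.intCast_zmod_eq_zero_iff_dvd (a + 3 * c + 2 * d) 5
  have e₃ := ZMod.intCast_zmod_eq_zero_iff_dvd (b + 3 * c - d) 5
  push_cast at e₁ e₂ e₃
  rw [← e₁, ← e₂, ← e₃]
  exact key _ _ _ _

/-- **`#{Q₅ = 5n} = #{Q₅ = n}`**: the `5`-map is a bijection from the solutions of `Q₅ = n` onto those of `Q₅ = 5n` (a solution of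
`Q₅ = 5n` satisfies the two congruences, and then `A = (a+2b+4c)/5`, `B = (a−b−2d)/5`, `C = (−2a−c+d)/5`, `D = (4b+2c+d)/5` is its
unique preimage). [cite: Eichler1973, Ch. II §2 and §6 Thm. 2 (20)] -/
theorem natCard_form_five_mul (n : ℤ) :
    Nat.card {v : ℤ × ℤ × ℤ × ℤ //
        v.1 ^ 2 + 2 * v.2.1 ^ 2 + 2 * v.2.2.1 ^ 2 + v.2.2.2 ^ 2 + v.1 * v.2.2.1 - v.1 * v.2.2.2 +
          2 * v.2.1 * v.2.2.1 + v.2.1 * v.2.2.2 = 5 * n} =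
      Nat.card {v : ℤ × ℤ × ℤ × ℤ //
        v.1 ^ 2 + 2 * v.2.1 ^ 2 + 2 * v.2.2.1 ^ 2 + v.2.2.2 ^ 2 + v.1 * v.2.2.1 - v.1 * v.2.2.2 +
          2 * v.2.1 * v.2.2.1 + v.2.1 * v.2.2.2 = n} := by
  symm
  refine Nat.card_congr (Equiv.ofBijective
    (fun v => ⟨(-v.1.1 - 2 * v.1.2.1 - 4 * v.1.2.2.1, -v.1.1 + v.1.2.1 + 2 * v.1.2.2.2, 2 * v.1.1 + v.1.2.2.1 - v.1.2.2.2,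
        -4 * v.1.2.1 - 2 * v.1.2.2.1 - v.1.2.2.2), by
      have h := form_fiveMap v.1.1 v.1.2.1 v.1.2.2.1 v.1.2.2.2
      rw [v.2] at h
      exact h⟩) ⟨?_, ?_⟩)
  · rintro ⟨⟨A, B, C, D⟩, hv⟩ ⟨⟨A', B', C', D'⟩, hv'⟩ h
    simp only [Subtype.mk.injEq, Prod.mk.injEq] at h
    obtain ⟨h1, h2, h3, h4⟩ := h
    have hA : A = A' := by omega
    have hB : B = B' := by omega
    have hC : C = C' := by omega
    have hD : D = D' := by omega
    subst hA hB hC hD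
    rfl
  · rintro ⟨⟨a, b, c, d⟩, h⟩
    have h5 : (5 : ℤ) ∣ a ^ 2 + 2 * b ^ 2 + 2 * c ^ 2 + d ^ 2 + a * c - a * d + 2 * b * c + b * d := ⟨n, h⟩
    obtain ⟨h₁, h₂⟩ := (five_dvd_form_iff a b c d).1 h5
    obtain ⟨A, hA⟩ : (5 : ℤ) ∣ a + 2 * b + 4 * c := by omega
    obtain ⟨B, hB⟩ : (5 : ℤ) ∣ a - b - 2 * d := by omega
    obtain ⟨C, hC⟩ : (5 : ℤ) ∣ -2 * a - c + d := by omega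
    obtain ⟨D, hD⟩ : (5 : ℤ) ∣ 4 * b + 2 * c + d := by omega
    refine ⟨⟨⟨A, B, C, D⟩, ?_⟩, ?_⟩
    · have ha : a = -A - 2 * B - 4 * C := by omega
      have hb : b = -A + B + 2 * D := by omega
      have hc : c = 2 * A + C - D := by omega
      have hd : d = -4 * B - 2 * C - D := by omega
      have e := form_fiveMap A B C D
      rw [← ha, ← hb, ← hc, ← hd, h] at e
      simpa using (mul_right_injective₀ (by norm_num : (5 : ℤ) ≠ 0) e).symm
    · simp only [Subtype.mk.injEq, Prod.mk.injEq]
      omega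

/-- **`#{Q₅ = 5ᵃn} = #{Q₅ = n}`** for every `a`. [cite: Eichler1973, Ch. II §6 Thm. 2 (20)] -/
theorem natCard_form_five_pow_mul (a : ℕ) (n : ℤ) :
    Nat.card {v : ℤ × ℤ × ℤ × ℤ //
        v.1 ^ 2 + 2 * v.2.1 ^ 2 + 2 * v.2.2.1 ^ 2 + v.2.2.2 ^ 2 + v.1 * v.2.2.1 - v.1 * v.2.2.2 +
          2 * v.2.1 * v.2.2.1 + v.2.1 * v.2.2.2 = 5 ^ a * n} =
      Nat.card {v : ℤ × ℤ × ℤ × ℤ //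
        v.1 ^ 2 + 2 * v.2.1 ^ 2 + 2 * v.2.2.1 ^ 2 + v.2.2.2 ^ 2 + v.1 * v.2.2.1 - v.1 * v.2.2.2 +
          2 * v.2.1 * v.2.2.1 + v.2.1 * v.2.2.2 = n} := by
  induction a with
  | zero => rw [pow_zero, one_mul]
  | succ a ih => rw [pow_succ, mul_comm ((5 : ℤ) ^ a) 5, mul_assoc, natCard_form_five_mul, ih]

/-- **`r₅(5ᵃ) = 6`**: the number of `(a,b,c,d) ∈ ℤ⁴` with `Q₅(a,b,c,d) = 5ᵃ` is `6` for every `a` (the six `jᵃu`, `u ∈ O₅^×`).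
[cite: Eichler1973, Ch. II §2 and §6 Thm. 2 (20)] [cite: Voight2021, Exercise 17.10] -/
theorem natCard_form_five_pow (a : ℕ) :
    Nat.card {v : ℤ × ℤ × ℤ × ℤ //
        v.1 ^ 2 + 2 * v.2.1 ^ 2 + 2 * v.2.2.1 ^ 2 + v.2.2.2 ^ 2 + v.1 * v.2.2.1 - v.1 * v.2.2.2 +
          2 * v.2.1 * v.2.2.1 + v.2.1 * v.2.2.2 = (5 : ℤ) ^ a} = 6 := by
  have h := natCard_form_five_pow_mul a 1
  rw [mul_one] at h
  rw [h, natCard_form_eq_one]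

end Form

/-! ## §2 For `O₅`: `#{nrd = 5n} = #{nrd = n}` -/

section Order

/-- **`#{x ∈ O₅ : nrd x = 5n} = #{x ∈ O₅ : nrd x = n}`** (`x ↦ jx`). [cite: Eichler1973, Ch. II §2 and §6 Thm. 2 (20)] [cite: VignerasLNM800, Ch. II §1 Lemme 1.5] -/
theorem natCard_reducedNorm_five_mul (n : ℕ) :
    Nat.card {x : ℍ[ℚ,-2,-5] // x ∈ (Submodule.span ℤ (Set.range ![(⟨1, 0, 0, 0⟩ : ℍ[ℚ,-2,-5]), ⟨0, 1, 0, 0⟩, ⟨1/2, 1/2, 1/2, 0⟩, ⟨-1/2, 1/4, 0, 1/4⟩])) ∧ reducedNorm ℚ ℍ[ℚ,-2,-5] x = (5 * n : ℕ)} =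
      Nat.card {x : ℍ[ℚ,-2,-5] // x ∈ (Submodule.span ℤ (Set.range ![(⟨1, 0, 0, 0⟩ : ℍ[ℚ,-2,-5]), ⟨0, 1, 0, 0⟩, ⟨1/2, 1/2, 1/2, 0⟩, ⟨-1/2, 1/4, 0, 1/4⟩])) ∧ reducedNorm ℚ ℍ[ℚ,-2,-5] x = n} := by
  have h5 := natCard_reducedNorm_eq_natCard_form ((5 * n : ℕ) : ℤ)
  have hn := natCard_reducedNorm_eq_natCard_form (n : ℤ)
  push_cast at h5 hn ⊢
  rw [h5, hn]
  exact natCard_form_five_mul n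

/-- **`#{x ∈ O₅ : nrd x = 5ᵃ} = 6`** for every `a`. [cite: Eichler1973, Ch. II §2] [cite: Voight2021, Exercise 17.10] -/
theorem natCard_reducedNorm_five_pow (a : ℕ) :
    Nat.card {x : ℍ[ℚ,-2,-5] // x ∈ (Submodule.span ℤ (Set.range ![(⟨1, 0, 0, 0⟩ : ℍ[ℚ,-2,-5]), ⟨0, 1, 0, 0⟩, ⟨1/2, 1/2, 1/2, 0⟩, ⟨-1/2, 1/4, 0, 1/4⟩])) ∧ reducedNorm ℚ ℍ[ℚ,-2,-5] x = (5 ^ a : ℕ)} = 6 := by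
  have h := natCard_reducedNorm_eq_natCard_form ((5 ^ a : ℕ) : ℤ)
  push_cast at h ⊢
  rw [h]
  exact natCard_form_five_pow a

/-- **For `x ∈ O₅` with `5 ∣ nrd x` there is `y ∈ O₅` with `x = jy`** (`𝔓 = jO₅` is the prime above `5`).
[cite: VignerasLNM800, Ch. II §1 Lemme 1.5] [cite: Voight2021, §13.3] -/
theorem exists_mem_eq_basisJ_mul_of_five_dvd {x : ℍ[ℚ,-2,-5]} (hx : x ∈ (Submodule.span ℤ (Set.range ![(⟨1, 0, 0, 0⟩ : ℍ[ℚ,-2,-5]), ⟨0, 1, 0, 0⟩, ⟨1/2, 1/2, 1/2, 0⟩, ⟨-1/2, 1/4, 0, 1/4⟩]))) (h5 : ∃ m : ℤ, reducedNorm ℚ ℍ[ℚ,-2,-5] x = 5 * m) :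
    ∃ y ∈ (Submodule.span ℤ (Set.range ![(⟨1, 0, 0, 0⟩ : ℍ[ℚ,-2,-5]), ⟨0, 1, 0, 0⟩, ⟨1/2, 1/2, 1/2, 0⟩, ⟨-1/2, 1/4, 0, 1/4⟩])), x = ⟨0, 0, 1, 0⟩ * y := by
  obtain ⟨m, hm⟩ := h5
  obtain ⟨a, b, c, d, rfl⟩ := (mem_lattice_iff x).1 hx
  rw [reducedNorm_mk] at hm
  have h5 : (5 : ℤ) ∣ a ^ 2 + 2 * b ^ 2 + 2 * c ^ 2 + d ^ 2 + a * c - a * d + 2 * b * c + b * d := ⟨m, by exact_mod_cast hm⟩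
  obtain ⟨h₁, h₂⟩ := (five_dvd_form_iff a b c d).1 h5
  obtain ⟨A, hA⟩ : (5 : ℤ) ∣ a + 2 * b + 4 * c := by omega
  obtain ⟨B, hB⟩ : (5 : ℤ) ∣ a - b - 2 * d := by omega
  obtain ⟨C, hC⟩ : (5 : ℤ) ∣ -2 * a - c + d := by omega
  obtain ⟨D, hD⟩ : (5 : ℤ) ∣ 4 * b + 2 * c + d := by omega
  refine ⟨_, mk_mem_lattice A B C D, ?_⟩
  rw [basisJ_mul_mk]
  have ha : a = -A - 2 * B - 4 * C := by omega
  have hb : b = -A + B + 2 * D := by omega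
  have hc : c = 2 * A + C - D := by omega
  have hd : d = -4 * B - 2 * C - D := by omega
  subst ha hb hc hd
  rfl

end Order

end Literature.NumberTheory.Automorphic.MaxOrderDiscFive
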